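import Summits.MatrixMultiplication.OmegaCensus.SmallFormats.MatMul22nRankGF7Slack5PatInv
import Summits.MatrixMultiplication.OmegaCensus.SmallFormats.MatMul22nRankGF7Slack5PatComplete
import Summits.MatrixMultiplication.OmegaCensus.SmallFormats.MatMul22nRankGF7Slots
import HarnessLib

/-!
# ω-census family (a): soundness of the interval-pruned pattern search; every slack-5 pattern is a slot pattern

Cell `pub-omega` (unit `pub-omega-tensor-g16`), topic `Summits/MatrixMultiplication/OmegaCensus` (sub-folder `SmallFormats`).
Framing (verbatim): lottery ticket; floor = certified bounds/negative ranges. HONEST FRAMING: kernel infrastructure, step P1 of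
`pub-omega-tensor-g16/KERNEL-S5-DESIGN.md`: `mem_pcands5` (the true value is always a candidate), the soundness of `pdfs5` / `preach5` and,
with the replayed certificate (`MatMul22nRankGF7Slack5PatComplete`), the completeness of the list of 5 683 normalised slack-5 patterns and the
slot decomposition of every slack-5 pattern (`slot_of_pat5`: `P = repVal5 c ∘ omAct7 h`, `c < 656`, `h < 336`). Nothing here is progress on `ω`.
-/

namespace Summit.MatrixMultiplication.OmegaCensus.SmallFormats

open Finset
open Literature.NumberTheory.NumberFields (list_sum_range_map)

/-! ## The true value is a candidate -/

/-- **Key step.** At step `k < 42` the true value of a normalised pattern of slack `s ≤ 6` is among the candidates. -/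
theorem mem_pcands5 {s : ℕ} (hs : s ≤ 6) {P : ℕ → ℕ} (hP : IsPat7 s P) (hN : IsNorm7 P) {k : ℕ} (hk : k < 42) :
    P (pOrd5 k) ∈ pcands5 s k (ApackI5 P k) (HpackI5 P k) := by
  obtain ⟨hinj, hlt, h0, h1⟩ := pOrd5_ok
  have hzk : pOrd5 k < 42 := hlt ⟨k, hk⟩
  have hPk : P (pOrd5 k) ≤ s := hP.1 _ hzk
  have hm : ∀ z < 42, P 18 ≤ P z := hN.1
  by_cases hk0 : k = 0
  · -- the first point is the minimum: 7 · P 18 ≤ 6s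
    subst hk0
    have e : pcands5 s 0 (ApackI5 P 0) (HpackI5 P 0) = List.range (6 * s / 7 + 1) := by simp [pcands5]
    rw [e, h0]
    have hb := hept_split5 hP hm (k := 0) (by norm_num) (j := 0) (by norm_num)
    rw [h0] at hb
    have hS : hsum5 P 0 (pHep5 0 0) = 0 := by unfold hsum5; simp
    have hc : pCnt5 0 0 = 0 := by decide
    rw [hS, hc] at hb
    apply List.mem_range.2
    have : P 18 * 7 ≤ 6 * s := by omega
    have := (Nat.le_div_iff_mul_le (by norm_num : 0 < 7)).2 this
    omega
  · have hd18 : fld 3 (ApackI5 P k) 18 = P 18 := by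
      rw [← h0, fld_ApackI5 hs hP.1 (by omega) (by norm_num), if_pos (by omega)]
    simp only [pcands5, hk0, ↓reduceIte, hd18]
    -- the interval facts for each of the 8 heptads
    have hiv : ∀ i < 8, hsum5 P k (pHep5 k i) + P (pOrd5 k) + (6 - pCnt5 k i) * P 18 ≤ 6 * s ∧
        6 * s ≤ hsum5 P k (pHep5 k i) + P (pOrd5 k) + (6 - pCnt5 k i) * s := fun i hi => hept_split5 hP hm hk hi
    have hS : ∀ i < 8, fld 8 (HpackI5 P k) (pHep5 k i) = hsum5 P k (pHep5 k i) :=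
      fun i hi => fld_HpackI5 hs hP (by omega) (pHep5_ok ⟨k, hk⟩ ⟨i, hi⟩).1
    -- not dead
    have hdead : ((List.range 8).any fun i => 6 * s < pHiArg5 k (HpackI5 P k) (P 18) i) = false := by
      rw [List.any_eq_false]
      intro i hi
      have hi8 := List.mem_range.1 hi
      simp only [decide_eq_true_eq, not_lt]
      unfold pHiArg5; rw [hS i hi8]; have := (hiv i hi8).1; omega
    rw [hdead]
    simp only [Bool.false_eq_true, ↓reduceIte]
    -- lower bound
    have hlo : max (max (P 18) (if pInO1_5 k then fld 3 (ApackI5 P k) 0 else 0))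
        (((List.range 8).map fun i => pLo5 s k (HpackI5 P k) i).foldr max 0) ≤ P (pOrd5 k) := by
      refine max_le (max_le (hm _ hzk) ?_) ?_
      · by_cases ho : pInO1_5 k = true
        · rw [if_pos ho]
          obtain ⟨h2, i, hi⟩ := pInO1_5_ok ⟨k, hk⟩ ho
          have h2' : 2 ≤ k := h2
          rw [← h1, fld_ApackI5 hs hP.1 (by omega) (by norm_num), if_pos (by omega), h1]
          have := hN.2 i.val i.isLt
          have hi' : orbO1_7 i.val = pOrd5 k := hi
          rw [hi'] at this; exact this
        · rw [if_neg ho]; exact Nat.zero_le _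
      · rw [foldr_max_le_iff]
        refine ⟨Nat.zero_le _, fun x hx => ?_⟩
        rw [List.mem_map] at hx
        obtain ⟨i, hi, rfl⟩ := hx
        have hi8 := List.mem_range.1 hi
        unfold pLo5; rw [hS i hi8]; have := (hiv i hi8).2; omega
    -- upper bound
    have hhi : P (pOrd5 k) ≤ min s (((List.range 8).map fun i => 6 * s - pHiArg5 k (HpackI5 P k) (P 18) i).foldr min s) := by
      refine le_min hPk ?_
      rw [le_foldr_min_iff]
      refine ⟨hPk, fun x hx => ?_⟩
      rw [List.mem_map] at hx
      obtain ⟨i, hi, rfl⟩ := hx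
      have hi8 := List.mem_range.1 hi
      unfold pHiArg5; rw [hS i hi8]; have := (hiv i hi8).1; omega
    apply List.mem_map.2
    refine ⟨P (pOrd5 k) - max (max (P 18) (if pInO1_5 k then fld 3 (ApackI5 P k) 0 else 0))
        (((List.range 8).map fun i => pLo5 s k (HpackI5 P k) i).foldr max 0), List.mem_range.2 (by omega), by omega⟩

/-! ## Soundness of the search and of the splitting -/

/-- **Soundness of `pdfs5`.** -/
theorem pdfs5_sound {s : ℕ} (hs : s ≤ 6) {mem : ℕ → Bool} {P : ℕ → ℕ} (hP : IsPat7 s P) (hN : IsNorm7 P) :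
    ∀ fuel k, k ≤ 42 → pdfs5 s mem fuel k (ApackI5 P k) (HpackI5 P k) = true → mem (packP5 P) = true := by
  intro fuel
  induction fuel with
  | zero => intro k _ h; simp [pdfs5] at h
  | succ fuel ih =>
    intro k hk h
    unfold pdfs5 at h
    by_cases h42 : 42 ≤ k
    · rw [if_pos h42] at h
      have hk42 : k = 42 := by omega
      subst hk42
      exact h
    · rw [if_neg h42] at h
      have hmem := mem_pcands5 hs hP hN (k := k) (by omega)
      have h' := List.all_eq_true.1 h _ hmem
      rw [← ApackI5_succ, ← HpackI5_succ] at h'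
      exact ih (k + 1) (by omega) h'

/-- **Soundness of `preach5`.** The depth-`D` state of a normalised pattern is reached from each of its shallower states. -/
theorem preach5_sound {s : ℕ} (hs : s ≤ 6) {D : ℕ} (hD : D ≤ 42) {P : ℕ → ℕ} (hP : IsPat7 s P) (hN : IsNorm7 P) :
    ∀ fuel k, k ≤ D → D - k < fuel → (ApackI5 P D, HpackI5 P D) ∈ preach5 s D fuel k (ApackI5 P k) (HpackI5 P k) := by
  intro fuel
  induction fuel with
  | zero => intro k _ h; omega
  | succ fuel ih =>
    intro k hk hf
    unfold preach5
    by_cases hDk : D ≤ k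
    · rw [if_pos hDk]
      have : k = D := by omega
      subst this; simp
    · rw [if_neg hDk, List.mem_flatMap]
      refine ⟨P (pOrd5 k), mem_pcands5 hs hP hN (k := k) (by omega), ?_⟩
      rw [← ApackI5_succ, ← HpackI5_succ]
      exact ih (k + 1) (by omega) (by omega)

/-- **Covering lemma.** If every depth-`D` state reached from the empty state passes `pdfs5`, every normalised pattern of slack
`s ≤ 6` passes the membership test. -/
theorem pcover5_sound {s : ℕ} (hs : s ≤ 6) {D : ℕ} (hD : D ≤ 42) {mem : ℕ → Bool} {fuel₁ fuel₂ : ℕ} (hf : D < fuel₁)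
    (hall : ∀ st ∈ preach5 s D fuel₁ 0 0 0, pdfs5 s mem fuel₂ D st.1 st.2 = true) {P : ℕ → ℕ} (hP : IsPat7 s P) (hN : IsNorm7 P) :
    mem (packP5 P) = true := by
  have hA0 : ApackI5 P 0 = 0 := by unfold ApackI5; simp
  have hH0 : HpackI5 P 0 = 0 := by unfold HpackI5; simp
  have hr := preach5_sound hs hD hP hN fuel₁ 0 (Nat.zero_le _) (by omega)
  rw [hA0, hH0] at hr
  exact pdfs5_sound hs hP hN fuel₂ D hD (hall _ hr)

/-! ## Completeness of the normalised list; slot decomposition -/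

/-- **Every normalised slack-5 pattern is listed.** -/
theorem normList5_complete {P : ℕ → ℕ} (hP : IsPat7 5 P) (hN : IsNorm7 P) : ∃ n < 5683, ∀ z < 42, P z = normVal5 n z := by
  have hall : ∀ st ∈ preach5 5 9 10 0 0 0, pdfs5 5 normMem5 34 9 st.1 st.2 = true := by
    intro st hst
    have hc : st ∈ allPStates5 := List.elem_iff.1 (List.all_eq_true.1 preach5_cover st hst)
    exact List.all_eq_true.1 allPStates5_ok st hc
  have hm := pcover5_sound (s := 5) (by norm_num) (by norm_num) (by norm_num) hall hP hN
  obtain ⟨n, hn, hpk⟩ := normMem5_sound hm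
  refine ⟨n, hn, fun z hz => ?_⟩
  unfold normVal5
  rw [hpk, fld_packP5 (s := 5) (by norm_num) hP.1 hz]

set_option maxRecDepth 100000 in
set_option maxHeartbeats 40000000 in
/-- Certificates, patterns `n < 2880`: class `< 656`, element `< 336`, and the pattern is the representative moved by the element. -/
theorem normCert5_ok_1 : ∀ n : Fin 5683, n.val < 2880 → normCls5 n.val < 656 ∧ normElt5 n.val < 336 ∧
    ∀ z : Fin 42, normVal5 n.val z.val = repVal5 (normCls5 n.val) (omAct7 (normElt5 n.val) z.val) := by
  decide +kernel

set_option maxRecDepth 100000 in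
set_option maxHeartbeats 40000000 in
/-- Certificates, patterns `2880 ≤ n < 5683`. -/
theorem normCert5_ok_2 : ∀ n : Fin 5683, 2880 ≤ n.val → normCls5 n.val < 656 ∧ normElt5 n.val < 336 ∧
    ∀ z : Fin 42, normVal5 n.val z.val = repVal5 (normCls5 n.val) (omAct7 (normElt5 n.val) z.val) := by
  decide +kernel

/-- Certificates for all `n < 5683`. -/
theorem normCert5_ok {n : ℕ} (hn : n < 5683) : normCls5 n < 656 ∧ normElt5 n < 336 ∧
    ∀ z < 42, normVal5 n z = repVal5 (normCls5 n) (omAct7 (normElt5 n) z) := by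
  have h : normCls5 n < 656 ∧ normElt5 n < 336 ∧ ∀ z : Fin 42, normVal5 n z.val = repVal5 (normCls5 n) (omAct7 (normElt5 n) z.val) := by
    by_cases h1 : n < 2880
    · exact normCert5_ok_1 ⟨n, hn⟩ h1
    · exact normCert5_ok_2 ⟨n, hn⟩ (by simp only; omega)
  exact ⟨h.1, h.2.1, fun z hz => h.2.2 ⟨z, hz⟩⟩

/-- **Every normalised slack-5 pattern is a class representative moved by an element of `PGL₂(7)`** (element and word form). -/
theorem norm_pattern_rep5 {P : ℕ → ℕ} (hP : IsPat7 5 P) (hN : IsNorm7 P) :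
    ∃ c < 656, ∃ h < 336, (∀ z < 42, P z = repVal5 c (omAct7 h z)) ∧ ∀ z < 42, P z = repVal5 c (lmulOmW7 (omWord7 h) z) := by
  obtain ⟨n, hn, hPn⟩ := normList5_complete hP hN
  obtain ⟨hc, hh, hval⟩ := normCert5_ok hn
  obtain ⟨hw, hact⟩ := omAct7_ok ⟨normElt5 n, hh⟩
  refine ⟨normCls5 n, hc, normElt5 n, hh, fun z hz => by rw [hPn z hz, hval z hz], fun z hz => ?_⟩
  rw [hPn z hz, hval z hz]
  have e : omAct7 (normElt5 n) z = lmulOmW7 (omWord7 (normElt5 n)) z := (hact ⟨z, hz⟩).1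
  rw [e]

/-- **Slot decomposition.** Every slack-5 pattern is `repVal5 c ∘ omAct7 h` for some class `c < 656` and element `h < 336`. -/
theorem slot_of_pat5 {P : ℕ → ℕ} (hP : IsPat7 5 P) : ∃ c < 656, ∃ h < 336, ∀ z < 42, P z = repVal5 c (omAct7 h z) := by
  obtain ⟨W, hW, hN⟩ := exists_norm_fun7 P
  have hPW : IsPat7 5 (fun z => P (lmulOmW7 W z)) := isPat7_comp W hW hP
  obtain ⟨c, hc, h, hh, _, hval⟩ := norm_pattern_rep5 hPW hN
  obtain ⟨hw, _⟩ := omAct7_ok ⟨h, hh⟩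
  obtain ⟨h', hh', hact⟩ := word_is_elem7 (omWord7 h ++ invWord7 W) (by
    intro k hk; rw [List.mem_append] at hk
    rcases hk with hk | hk
    · exact hw k hk
    · exact invWord7_letters hW k hk)
  refine ⟨c, hc, h', hh', fun z hz => ?_⟩
  have hz' : lmulOmW7 (invWord7 W) z < 42 := lmulOmW7_lt (invWord7_letters hW) hz
  have e1 : P z = P (lmulOmW7 W (lmulOmW7 (invWord7 W) z)) := by rw [word_inv7 hW hz]
  rw [e1, hval _ hz', ← lmulOmW7_append, hact z hz]

end Summit.MatrixMultiplication.OmegaCensus.SmallFormats
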